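import Summits.Ventures.GridStability.Bench.NE39SPStepDefs
import Summits.Ventures.GridStability.Lyapunov.StructurePreservingStepRoaR
import HarnessLib

/-!
# GridStability/Bench/NE39SPStepR — the injection-step theorem VERSION R (per-edge Vu–Turitsyn level) specialised to
# the 49-node STRUCTURE-PRESERVING New England instance (line «G2.b-NE39SP-LOADSTEP», v2 wrapper)

Cell `gridfusion` (LADDER-GRIDFUSION), seat gridfusion-lyap-1 (g9). Same objects as `Bench/NE39SPStepDefs.lean` (`P0Q`,
`Pstep`, `paramsStep`, model-2's `Models/NE39SP.lean` [cite: Padiyar2013, App. D]); the generic theorem is this seat's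
`Switch.step_resync_of_checkR` (`Lyapunov/StructurePreservingStepRoaR.lean`): the certificate's edge conjunct is the
PER-EDGE enclosure-robust gap `c < wₑ·ratGapR(q̃ₑ, 2R)` instead of the uniform `2cos γ − 3.141593 sin γ`, so post-step
coupled branch angles beyond ≈ 32.5° certify (used by `Bench/NE39SPLoadStepG1*.lean`: load pickup supplied by the
30-s machine G1, whose internal angle reaches ≈ 36°). NO data literal, no definition; no named fact; standard axioms.
No sentence here says the New England system is stable.
-/

noncomputable section

open Set Filter Topology Real Finset
open Summit.Ventures.GridStability.Models
open Summit.Ventures.GridStability.Models.StructurePreserving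
open Summit.Ventures.GridStability.Models.NE39SP
open Summit.Ventures.GridStability.Lyapunov.StructurePreserving
open Summit.Ventures.GridStability.Lyapunov.StructurePreserving.Switch

namespace Summit.Ventures.GridStability.Bench.NE39SP

/-- **THE INJECTION-STEP THEOREM (version R) FOR THE NEW ENGLAND SP INSTANCE, modulo one rational check.** For
nodes `i` (load pickup) and `g` (supplying machine), a step `s`, and a certificate `C` with
`C.checkR srcV tgtV wtLFQ (Pstep i g s) tLFQ 39`: for EVERY `D > 0` the post-step model `paramsStep i g s D` HAS a
synchronous angle vector `θ` (all 49 equations exactly; `|θⱼ − θ̃ⱼ| < R`; coupled branches inside `2·arctan τγ`), and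
EVERY solution from the PRE-step synchronous state (`δ(0) = δ₀`, zero machine speeds) keeps Vu–Turitsyn's polytope
and `V(θ; ·) ≤ c` for all `t ≥ 0`, converges to `θ + κ·1` (`κ = Σ Dⱼ(δ₀ⱼ − θⱼ)/Σ Dⱼ`) with machine speeds `→ 0`.
MODEL MV-3; no sentence here says the New England system is stable. [cite: VuTuritsyn2016, §IV, §VI, Appendix 9.3] -/
theorem stepR_resync_NE39SP {i g : Fin 49} {s : ℚ} {C : Cert 49 56}
    (hchk : C.checkR NE39SP.srcV NE39SP.tgtV NE39SP.wtLFQ (Pstep i g s) NE39SP.tLFQ 39)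
    (D : Fin 49 → ℝ) (hD : ∀ j, 0 < D j) :
    ∃ θ : Fin 49 → ℝ,
      θ 39 = halfAngle (fun j => (C.t1 j : ℝ)) 39 ∧
      (∀ j, |θ j - halfAngle (fun j => (C.t1 j : ℝ)) j| < (C.R : ℝ)) ∧
      (∀ j, (paramsStep i g s D).pe θ j = (paramsStep i g s D).P0 j) ∧
      (∀ a b, a ≠ b → (paramsStep i g s D).b a b ≠ 0 → |θ a - θ b| < 2 * Real.arctan (C.τγ : ℝ)) ∧
      ∀ δ : ℝ → Fin 49 → ℝ, (paramsStep i g s D).IsSolution δ → δ 0 = NE39SP.δ₀ →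
        (∀ j ∈ NE39SP.genS, deriv (fun u => δ u j) 0 = 0) →
        (∀ t, 0 ≤ t →
            (∀ a b, (paramsStep i g s D).b a b ≠ 0 → |(δ t a - δ t b) + (θ a - θ b)| < π) ∧
              (paramsStep i g s D).energy θ (δ t) (fun j => deriv (fun u => δ u j) t) ≤ (C.c : ℝ)) ∧
          Tendsto δ atTop (𝓝 fun j => θ j + (∑ k, D k * (NE39SP.δ₀ k - θ k)) / ∑ k, D k) ∧
          ∀ j ∈ NE39SP.genS, Tendsto (fun t => deriv (fun u => δ u j) t) atTop (𝓝 0) :=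
  step_resync_of_checkR hchk (by decide) (paramsStep_wellFormed i g s hD) (paramsStep_b i g s D)
    (paramsStep_P0 i g s D)

end Summit.Ventures.GridStability.Bench.NE39SP

end
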